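import Summits.Schanuel.Schanuel.Theorems.ZilberEacParamSurfaceRealRatioZeros
import Summits.Schanuel.Schanuel.Theorems.ZilberEacParamFibreCurveGapComplete
import Summits.Schanuel.Schanuel.Theorems.ZilberEacLineBaseComplete
import HarnessLib

/-!
# Polynomially parametrised base curves, XLVII: EVERY surface of Mantova–Masser's case over an
# equal-degree curve with real IRRATIONAL leading ratio has Zariski-dense exponential points

HONEST FRAMING.  Cell `pub-schanuel` (Zilber's Exponential-Algebraic Closedness, case ladder;
host summit Schanuel), seat 2, gen 21.  Assembly: non-split `Q` (two `y₁`-degrees) is file XLVI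
(no curvature condition); `Q ∈ ℂ[t, y₀]` with two `y₀`-degrees is the real-ratio fibre-curve
theorem of file XL; the trichotomy (XXII) and the dictionary (XXIV) give
**`unprojectedDense_of_mmCase_of_base_eq_realIrrational`**: every `W ⊆ ℂ² × ℂ²` in
Mantova–Masser's case (dim-π-S-1-free) whose base curve is `{(g₀(t), g₁(t))}` with
`deg g₀ = deg g₁ ≥ 2` and `lc(g₁)/lc(g₀) ∈ ℝ ∖ ℚ` has Zariski-dense exponential points, with NO
further hypothesis (if `lc₀ g₁ - lc₁ g₀` is constant the base is a line of irrational slope and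
gen 18's all-lines theorem applies); e.g. every `W` over `(x₁ - √2 x₀)³ = x₀` (`(t³, √2 t³ + t)`:
proportional sub-leading coefficients, outside gen 20).  With gen 20 (non-real ratio) and files
XXXVII/XLI (rational ratio, reduced to unequal degrees) the equal-degree row of the node map is
decided up to the residual of the unequal-degree row for the reduced pair;
`unprojectedDense_of_mmCase_of_base_eq_paramCurve_master₃` collects everything.  What stays OPEN
over polynomial curves with both degrees `≥ 2`: the fibre-curve (cylinder) class with `d ∣ n`,
vanishing phase, no gap and top row spanning both extreme columns (equimodular candidates) — for
the pair itself or for the reduced pair of a rational ratio; general algebraic curves; Fib(3,2);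
EC(3,2).  Mantova–Masser's question is OPEN in general (PLMS 2024 §1 p. 5); NOT Schanuel's
conjecture (neither used nor implied; EAC ⇏ SC).
-/

noncomputable section

open Filter Topology Set Complex MvPolynomial
open Literature.NumberTheory.Transcendental Literature.ModelTheory.Zilber
open Literature.ModelTheory.ExponentialFields

set_option linter.dupNamespace false

namespace Summit.Schanuel.Schanuel.Theorems

section Main

variable (g₀ g₁ : Polynomial ℂ) {Q : MvPolynomial (Fin 3) ℂ}

/-- **Non-split surfaces over an equal-degree curve with real irrational ratio, no curvature
condition.**  `deg g₀ = deg g₁ = n ≥ 2`, `Im(lc₁/lc₀) = 0`, `Re(lc₁/lc₀)` irrational,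
`lc₀ g₁ - lc₁ g₀` non-constant; `Q` irreducible with two `y₁`-degrees ⟹ dense exponential points.
[cite: MantovaMasser2023, §1 Further remarks, p. 5 (the question, open in general)] (new) -/
theorem unprojectedDense_paramSurface₃_of_realRatio (hn : 2 ≤ g₀.natDegree)
    (heq : g₁.natDegree = g₀.natDegree) (him : (g₁.leadingCoeff / g₀.leadingCoeff).im = 0)
    (hirrat : Irrational (g₁.leadingCoeff / g₀.leadingCoeff).re)
    (hD : 1 ≤ (Polynomial.C g₀.leadingCoeff * g₁ - Polynomial.C g₁.leadingCoeff * g₀).natDegree)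
    (hirr : Irreducible Q) (h2 : ∃ m ∈ Q.support, ∃ m' ∈ Q.support, m 2 ≠ m' 2) :
    UnprojectedDense {w : Fin 2 ⊕ Fin 2 → ℂ | ∃ t : ℂ, w (Sum.inl 0) = g₀.eval t ∧
      w (Sum.inl 1) = g₁.eval t ∧
      MvPolynomial.eval (Fin.cases t (fun i => w (Sum.inr i)) : Fin 3 → ℂ) Q = 0} := by
  have hg₀ : 1 ≤ g₀.natDegree := by omega
  obtain ⟨t, ht, hgr⟩ := exists_paramSurface_expPoints_of_realRatio g₀ g₁ hn heq him hirrat hD Q h2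
  exact unprojectedDense_paramSurface₃_of_expPoints g₀ g₁ Q ht hgr
    (isIrreducibleClosed_paramSurface₃ g₀ g₁ hg₀ hirr)
    (by rw [zariskiDim_paramSurface₃ g₀ g₁ hg₀ hirr])

/-- **Complete theorem over an equal-degree curve with real irrational ratio that is not a line.**
Every irreducible `Q ∈ ℂ[t, y₀, y₁]` with a zero in `(ℂˣ)²` over infinitely many `t` gives a
surface `S(g; Q)` of the case with Zariski-dense exponential points. [cite: MantovaMasser2023,
§1 Further remarks, p. 5 (the question, open in general)] (new) -/
theorem unprojectedDensityQuestion_paramSurface₃_complete_of_realIrrational (hn : 2 ≤ g₀.natDegree)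
    (heq : g₁.natDegree = g₀.natDegree) (him : (g₁.leadingCoeff / g₀.leadingCoeff).im = 0)
    (hirrat : Irrational (g₁.leadingCoeff / g₀.leadingCoeff).re)
    (hD : 1 ≤ (Polynomial.C g₀.leadingCoeff * g₁ - Polynomial.C g₁.leadingCoeff * g₀).natDegree)
    (hirr : Irreducible Q)
    (hfib : Set.Infinite {t : ℂ | ∃ c : Fin 2 → ℂ, c 0 ≠ 0 ∧ c 1 ≠ 0 ∧
      MvPolynomial.eval ![t, c 0, c 1] Q = 0}) :
    MMCaseDimPiOneFree {w : Fin 2 ⊕ Fin 2 → ℂ | ∃ t : ℂ, w (Sum.inl 0) = g₀.eval t ∧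
        w (Sum.inl 1) = g₁.eval t ∧
        MvPolynomial.eval (Fin.cases t (fun i => w (Sum.inr i)) : Fin 3 → ℂ) Q = 0} ∧
      UnprojectedDense {w : Fin 2 ⊕ Fin 2 → ℂ | ∃ t : ℂ, w (Sum.inl 0) = g₀.eval t ∧
        w (Sum.inl 1) = g₁.eval t ∧
        MvPolynomial.eval (Fin.cases t (fun i => w (Sum.inr i)) : Fin 3 → ℂ) Q = 0} := by
  have hg₀ : 1 ≤ g₀.natDegree := by omega
  have hcase := mmCase_paramSurface₃ g₀ g₁ hg₀ (paramCurve_indep_of_remainder g₀ g₁ hg₀ heq hD)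
    hirr hfib
  rcases two_y1_degrees_or_y0_of_torusFibres hirr hfib with h2 | ⟨hQ2, h1⟩
  · exact ⟨hcase, unprojectedDense_paramSurface₃_of_realRatio g₀ g₁ hn heq him hirrat hD hirr h2⟩
  · exact ⟨hcase, unprojectedDense_paramSurface₃_of_y0_realRatio g₀ g₁ hn heq him hD hirr hQ2 h1⟩

/-- If `lc₀ g₁ - lc₁ g₀` is constant (`deg g₀ ≥ 1`), the curve `{(g₀(t), g₁(t))}` is the line
`x₁ = (lc₁/lc₀) x₀ + b`. (new) -/
theorem paramCurve_eq_line_of_natDegree_eq_zero (hg₀ : 1 ≤ g₀.natDegree)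
    (h0 : (Polynomial.C g₀.leadingCoeff * g₁ - Polynomial.C g₁.leadingCoeff * g₀).natDegree = 0) :
    ∃ b : ℂ, {x : Fin 2 → ℂ | ∃ t : ℂ, x 0 = g₀.eval t ∧ x 1 = g₁.eval t} =
      {x : Fin 2 → ℂ | x 1 = g₁.leadingCoeff / g₀.leadingCoeff * x 0 + b} := by
  have hg0 : g₀ ≠ 0 := by rintro rfl; rw [Polynomial.natDegree_zero] at hg₀; omega
  have ha0 : g₀.leadingCoeff ≠ 0 := Polynomial.leadingCoeff_ne_zero.2 hg0
  obtain ⟨Dn, hDn⟩ : ∃ Dn : Polynomial ℂ,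
      Dn = Polynomial.C g₀.leadingCoeff * g₁ - Polynomial.C g₁.leadingCoeff * g₀ := ⟨_, rfl⟩
  rw [← hDn] at h0
  obtain ⟨c, hc⟩ : ∃ c : ℂ, Dn = Polynomial.C c :=
    ⟨Dn.coeff 0, Polynomial.eq_C_of_natDegree_eq_zero h0⟩
  refine ⟨c / g₀.leadingCoeff, ?_⟩
  have hev : ∀ t : ℂ, g₁.eval t = g₁.leadingCoeff / g₀.leadingCoeff * g₀.eval t +
      c / g₀.leadingCoeff := by
    intro t
    have h := congrArg (Polynomial.eval t) hc
    rw [hDn] at h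
    simp only [Polynomial.eval_sub, Polynomial.eval_mul, Polynomial.eval_C] at h
    field_simp
    linear_combination h
  ext x
  simp only [Set.mem_setOf_eq]
  constructor
  · rintro ⟨t, h0', h1'⟩
    rw [h1', h0', hev t]
  · intro hx
    -- `g₀` is onto: pick `t` with `g₀(t) = x 0`
    have hdegpos : 0 < g₀.degree := Polynomial.natDegree_pos_iff_degree_pos.1 (by omega)
    have hdeg : 0 < (g₀ - Polynomial.C (x 0)).degree := by
      rwa [Polynomial.degree_sub_eq_left_of_degree_lt (lt_of_le_of_lt Polynomial.degree_C_le hdegpos)]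
    obtain ⟨t, ht⟩ := Complex.exists_root hdeg
    rw [Polynomial.IsRoot, Polynomial.eval_sub, Polynomial.eval_C, sub_eq_zero] at ht
    exact ⟨t, ht.symm, by rw [hx, hev t, ht]⟩

/-- **LITERAL CAPSTONE (equal degrees, real IRRATIONAL leading ratio — no further hypothesis).**
Every `W ⊆ ℂ² × ℂ²` in Mantova–Masser's case (dim-π-S-1-free) whose base curve is
`{(g₀(t), g₁(t))}` with `deg g₀ = deg g₁ ≥ 2` and `lc(g₁)/lc(g₀) ∈ ℝ ∖ ℚ` has Zariski-dense
exponential points. [cite: MantovaMasser2023, §1 Further remarks, p. 5 (the question, open in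
general)] (new) -/
theorem unprojectedDense_of_mmCase_of_base_eq_realIrrational (hn : 2 ≤ g₀.natDegree)
    (heq : g₁.natDegree = g₀.natDegree) (him : (g₁.leadingCoeff / g₀.leadingCoeff).im = 0)
    (hirrat : Irrational (g₁.leadingCoeff / g₀.leadingCoeff).re)
    {W : Set (Fin 2 ⊕ Fin 2 → ℂ)} (hmm : MMCaseDimPiOneFree W)
    (hbase : zeroLocus ℂ (vanishingIdeal ℂ (projAdd '' (W ∩ torusLocus ℂ 2))) =
      {x : Fin 2 → ℂ | ∃ t : ℂ, x 0 = g₀.eval t ∧ x 1 = g₁.eval t}) :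
    UnprojectedDense W := by
  by_cases hD : 1 ≤ (Polynomial.C g₀.leadingCoeff * g₁ - Polynomial.C g₁.leadingCoeff * g₀).natDegree
  · obtain ⟨Q, hQ, hfib, rfl⟩ := exists_eq_paramSurface₃_of_mmCase g₀ g₁ (by omega) hmm hbase
    exact (unprojectedDensityQuestion_paramSurface₃_complete_of_realIrrational g₀ g₁ hn heq him
      hirrat hD hQ hfib).2
  · obtain ⟨b, hb⟩ := paramCurve_eq_line_of_natDegree_eq_zero g₀ g₁ (by omega) (by omega)
    rw [hb] at hbase
    exact unprojectedDense_of_mmCase_of_base_eq_line _ b hmm hbase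

/-- **Mantova–Masser's question, literally, over an equal-degree curve with real irrational ratio:**
`MMCaseDimPiOneFree W → UnprojectedDense W`. [cite: MantovaMasser2023, §1 Further remarks, p. 5
(the question, open in general)] (new) -/
theorem unprojectedDensityQuestion_of_base_eq_realIrrational (hn : 2 ≤ g₀.natDegree)
    (heq : g₁.natDegree = g₀.natDegree) (him : (g₁.leadingCoeff / g₀.leadingCoeff).im = 0)
    (hirrat : Irrational (g₁.leadingCoeff / g₀.leadingCoeff).re)
    {W : Set (Fin 2 ⊕ Fin 2 → ℂ)}
    (hbase : zeroLocus ℂ (vanishingIdeal ℂ (projAdd '' (W ∩ torusLocus ℂ 2))) =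
      {x : Fin 2 → ℂ | ∃ t : ℂ, x 0 = g₀.eval t ∧ x 1 = g₁.eval t}) :
    MMCaseDimPiOneFree W → UnprojectedDense W := fun hmm =>
  unprojectedDense_of_mmCase_of_base_eq_realIrrational g₀ g₁ hn heq him hirrat hmm hbase

end Main

/-! ## The master capstone, third edition -/

/-- **MASTER CAPSTONE over polynomially parametrised base curves, third edition.**  Let
`deg g₀, deg g₁ ≥ 2` and assume ONE of: (i) `deg g₀ < deg g₁` with [`d ∤ n` or non-vanishing phase
or the gap]; (ii) the mirror of (i); (iii) `deg g₀ = deg g₁` with non-real leading ratio;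
(iv) `deg g₀ = deg g₁` with real IRRATIONAL leading ratio (nothing else); (v) `deg g₀ = deg g₁`
with RATIONAL leading ratio and the reduced pair in regime (i).  Then EVERY `W ⊆ ℂ² × ℂ²` of
Mantova–Masser's case whose base curve is `{(g₀(t), g₁(t))}` has Zariski-dense exponential points.
[cite: MantovaMasser2023, §1 Further remarks, p. 5 (the question, open in general)] (new) -/
theorem unprojectedDense_of_mmCase_of_base_eq_paramCurve_master₃ (g₀ g₁ : Polynomial ℂ)
    (hd₀ : 2 ≤ g₀.natDegree) (hd₁ : 2 ≤ g₁.natDegree)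
    (h : (g₀.natDegree < g₁.natDegree ∧ (¬ g₀.natDegree ∣ g₁.natDegree ∨
        (g₁.leadingCoeff * (I / g₀.leadingCoeff) ^ (g₁.natDegree / g₀.natDegree)).re ≠ 0 ∨
        g₁.natDegree < (Polynomial.C (g₀.leadingCoeff ^ (g₁.natDegree / g₀.natDegree)) * g₁ -
            Polynomial.C g₁.leadingCoeff * g₀ ^ (g₁.natDegree / g₀.natDegree)).natDegree +
          g₀.natDegree)) ∨
      (g₁.natDegree < g₀.natDegree ∧ (¬ g₁.natDegree ∣ g₀.natDegree ∨
        (g₀.leadingCoeff * (I / g₁.leadingCoeff) ^ (g₀.natDegree / g₁.natDegree)).re ≠ 0 ∨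
        g₀.natDegree < (Polynomial.C (g₁.leadingCoeff ^ (g₀.natDegree / g₁.natDegree)) * g₀ -
            Polynomial.C g₀.leadingCoeff * g₁ ^ (g₀.natDegree / g₁.natDegree)).natDegree +
          g₁.natDegree)) ∨
      (g₁.natDegree = g₀.natDegree ∧ (g₁.leadingCoeff / g₀.leadingCoeff).im ≠ 0) ∨
      (g₁.natDegree = g₀.natDegree ∧ (g₁.leadingCoeff / g₀.leadingCoeff).im = 0 ∧
        Irrational (g₁.leadingCoeff / g₀.leadingCoeff).re) ∨
      (g₁.natDegree = g₀.natDegree ∧ ∃ p q u v : ℤ, p * u + q * v = 1 ∧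
        (p : ℂ) * g₀.leadingCoeff + (q : ℂ) * g₁.leadingCoeff = 0 ∧
        2 ≤ (Polynomial.C (p : ℂ) * g₀ + Polynomial.C (q : ℂ) * g₁).natDegree ∧
        (¬ (Polynomial.C (p : ℂ) * g₀ + Polynomial.C (q : ℂ) * g₁).natDegree ∣ g₀.natDegree ∨
          ((Polynomial.C (u : ℂ) * g₁ - Polynomial.C (v : ℂ) * g₀).leadingCoeff *
              (I / (Polynomial.C (p : ℂ) * g₀ + Polynomial.C (q : ℂ) * g₁).leadingCoeff) ^
                (g₀.natDegree / (Polynomial.C (p : ℂ) * g₀ + Polynomial.C (q : ℂ) * g₁).natDegree)).re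
            ≠ 0 ∨
          g₀.natDegree <
            (Polynomial.C ((Polynomial.C (p : ℂ) * g₀ + Polynomial.C (q : ℂ) * g₁).leadingCoeff ^
                  (g₀.natDegree / (Polynomial.C (p : ℂ) * g₀ + Polynomial.C (q : ℂ) * g₁).natDegree)) *
                (Polynomial.C (u : ℂ) * g₁ - Polynomial.C (v : ℂ) * g₀) -
              Polynomial.C (Polynomial.C (u : ℂ) * g₁ - Polynomial.C (v : ℂ) * g₀).leadingCoeff *
                (Polynomial.C (p : ℂ) * g₀ + Polynomial.C (q : ℂ) * g₁) ^
                  (g₀.natDegree / (Polynomial.C (p : ℂ) * g₀ + Polynomial.C (q : ℂ) * g₁).natDegree)).natDegree +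
            (Polynomial.C (p : ℂ) * g₀ + Polynomial.C (q : ℂ) * g₁).natDegree)))
    {W : Set (Fin 2 ⊕ Fin 2 → ℂ)} (hmm : MMCaseDimPiOneFree W)
    (hbase : zeroLocus ℂ (vanishingIdeal ℂ (projAdd '' (W ∩ torusLocus ℂ 2))) =
      {x : Fin 2 → ℂ | ∃ t : ℂ, x 0 = g₀.eval t ∧ x 1 = g₁.eval t}) :
    UnprojectedDense W := by
  rcases h with ⟨hlt, hph⟩ | ⟨hgt, hph⟩ | ⟨heq, him⟩ | ⟨heq, him, hirrat⟩ |
    ⟨heq, p, q, u, v, hbez, hpq, hm, hreg⟩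
  · exact unprojectedDense_of_mmCase_of_base_eq_paramCurve₃ g₀ g₁ hd₀ hlt hph hmm hbase
  · exact unprojectedDense_of_mmCase_of_base_eq_paramCurve₃_of_gt g₀ g₁ hd₁ hgt hph hmm hbase
  · exact unprojectedDense_of_mmCase_of_base_eq_paramCurve_of_eq g₀ g₁ hd₀ heq him hmm hbase
  · exact unprojectedDense_of_mmCase_of_base_eq_realIrrational g₀ g₁ hd₀ heq him hirrat hmm hbase
  · exact unprojectedDense_of_mmCase_of_base_eq_paramCurve_of_ratRatio₃ g₀ g₁ hbez hd₀ heq hpq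
      rfl rfl hm hreg hmm hbase

/-! ## Example: every surface of the case over `(x₁ - √2 x₀)³ = x₀` -/

/-- The curve `(x₁ - √2 x₀)³ = x₀` is `{(t³, √2 t³ + t)}`. (new) -/
theorem sqrtTwoCubicCurve_eq_paramCurve :
    {x : Fin 2 → ℂ | (x 1 - ((Real.sqrt 2 : ℝ) : ℂ) * x 0) ^ 3 = x 0} =
      {x : Fin 2 → ℂ | ∃ t : ℂ, x 0 = (Polynomial.X ^ 3 : Polynomial ℂ).eval t ∧
        x 1 = (Polynomial.C ((Real.sqrt 2 : ℝ) : ℂ) * Polynomial.X ^ 3 + Polynomial.X :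
          Polynomial ℂ).eval t} := by
  ext x
  simp only [Set.mem_setOf_eq, Polynomial.eval_pow, Polynomial.eval_X, Polynomial.eval_add,
    Polynomial.eval_mul, Polynomial.eval_C]
  constructor
  · intro h
    exact ⟨x 1 - ((Real.sqrt 2 : ℝ) : ℂ) * x 0, h.symm, by rw [h]; ring⟩
  · rintro ⟨t, h0, h1⟩
    rw [h1, h0]; ring

/-- `deg (√2 X³ + X) = 3`. -/
theorem natDegree_sqrtTwo_X_cube_add_X :
    (Polynomial.C ((Real.sqrt 2 : ℝ) : ℂ) * Polynomial.X ^ 3 + Polynomial.X : Polynomial ℂ).natDegree =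
      3 := by
  have h0 : ((Real.sqrt 2 : ℝ) : ℂ) ≠ 0 := by
    rw [Complex.ofReal_ne_zero]; positivity
  rw [Polynomial.natDegree_add_eq_left_of_natDegree_lt] <;>
    simp [Polynomial.natDegree_C_mul_X_pow 3 _ h0]

/-- `lc (√2 X³ + X) = √2`. -/
theorem leadingCoeff_sqrtTwo_X_cube_add_X :
    (Polynomial.C ((Real.sqrt 2 : ℝ) : ℂ) * Polynomial.X ^ 3 + Polynomial.X :
      Polynomial ℂ).leadingCoeff = ((Real.sqrt 2 : ℝ) : ℂ) := by
  rw [Polynomial.leadingCoeff, natDegree_sqrtTwo_X_cube_add_X]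
  simp [Polynomial.coeff_X]

/-- **Every `W` of Mantova–Masser's case whose base curve is `(x₁ - √2 x₀)³ = x₀` has Zariski-dense
exponential points** (`(t³, √2 t³ + t)`: equal degrees `3`, ratio `√2 ∈ ℝ ∖ ℚ`, sub-leading
coefficients proportional (`t²` absent) — outside gen 20's curved-real theorem, decided by the
remainder `t` of degree `1`). [cite: MantovaMasser2023, §1 Further remarks, p. 5 (the question,
open in general)] (new) -/
theorem unprojectedDense_of_mmCase_of_base_eq_sqrtTwoCubicCurve {W : Set (Fin 2 ⊕ Fin 2 → ℂ)}
    (hmm : MMCaseDimPiOneFree W)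
    (hbase : zeroLocus ℂ (vanishingIdeal ℂ (projAdd '' (W ∩ torusLocus ℂ 2))) =
      {x : Fin 2 → ℂ | (x 1 - ((Real.sqrt 2 : ℝ) : ℂ) * x 0) ^ 3 = x 0}) :
    UnprojectedDense W := by
  rw [sqrtTwoCubicCurve_eq_paramCurve] at hbase
  have hd3 : (Polynomial.X ^ 3 : Polynomial ℂ).natDegree = 3 := by simp
  have hlc3 : (Polynomial.X ^ 3 : Polynomial ℂ).leadingCoeff = 1 := by simp
  refine unprojectedDense_of_mmCase_of_base_eq_realIrrational (Polynomial.X ^ 3)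
    (Polynomial.C ((Real.sqrt 2 : ℝ) : ℂ) * Polynomial.X ^ 3 + Polynomial.X) (by rw [hd3]; norm_num)
    (by rw [hd3, natDegree_sqrtTwo_X_cube_add_X]) ?_ ?_ hmm hbase
  · rw [hlc3, leadingCoeff_sqrtTwo_X_cube_add_X]; simp
  · rw [hlc3, leadingCoeff_sqrtTwo_X_cube_add_X]
    simpa using irrational_sqrt_two

end Summit.Schanuel.Schanuel.Theorems
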